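import Literature.NumberTheory.GaloisCohomology.KatoCohomologyPurity
import Literature.NumberTheory.GaloisCohomology.KatoCohomologyDifferentialForms
import Mathlib.Algebra.CharP.Algebra
import Mathlib.Algebra.Group.Subgroup.Map
import HarnessLib

/-!
# Stub `stub_purityTransport` of crux stmt-ResolutionOfSingularities-17142
# (`WildPurity.PurityTransfer`, line `birth`, lead c1 skeleton rev L4)

TRANSPORT of Gersten purity along the Bloch–Kato isomorphism.  The lead split the named fact
`GrosSuwa1988_purity` (Gersten purity for Kato's `H^{n+1}_p` at points of smooth schemes over perfect
fields, SYMBOLIC presentation `KatoCohomologySymbolic` / `integralSymbols` / `heightOneIntegralSymbols`)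
into

* (BK) the Bloch–Kato presentation `BlochKato1986_symbolicPresentation`: an additive isomorphism
  `e : KatoCohomologySymbolic p K n ≃+ KatoCohomologyDeRham p K n` with `e [a, b} = formClass p a b`;
* (dR) the same purity statement written on differential-form classes (`KatoCohomologyDeRham`,
  `formClass`, `localizationIn`).

This file proves (BK) + (dR) ⇒ `GrosSuwa1988_purity` (both taken as hypotheses; nothing is discharged
here).  It is pure bookkeeping: `e` maps `integralSymbols p n T` — the subgroup generated by the
`T`-integral symbols — onto the subgroup generated by the `T`-integral form classes
(`AddMonoidHom.map_closure`), for every `T ⊆ K`; membership is then moved back and forth with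
`AddSubgroup.mem_map_equiv`.
-/

set_option linter.dupNamespace false

noncomputable section

universe u

open Literature.NumberTheory.GaloisCohomology
open Literature.NumberTheory.GaloisCohomology.KatoCohomologySymbolic

namespace Summit.ResolutionOfSingularities.ResolutionOfSingularities.Theorems.WildPurityPurityTransfer

/-- An additive isomorphism `e : KatoCohomologySymbolic p K n ≃+ KatoCohomologyDeRham p K n` sending each
symbol `[a, b}` to the form class `formClass p a b` maps the subgroup `integralSymbols p n T` of
`T`-integral symbols onto the subgroup generated by the `T`-integral form classes, for every `T ⊆ K`
(image of a closure is the closure of the image). [folklore] -/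
theorem purityTransport_map_integralSymbols {p : ℕ} {K : Type u} [CommRing K] {n : ℕ}
    (e : KatoCohomologySymbolic p K n ≃+ KatoCohomologyDeRham p K n)
    (he : ∀ (a : K) (b : Fin n → Kˣ), e (KatoCohomologySymbolic.symbol p a b) = formClass p a b)
    (T : Set K) :
    (integralSymbols p n T).map e.toAddMonoidHom =
      AddSubgroup.closure {x : KatoCohomologyDeRham p K n | ∃ (a : K) (b : Fin n → Kˣ),
        a ∈ T ∧ (∀ i, (b i : K) ∈ T ∧ (((b i)⁻¹ : Kˣ) : K) ∈ T) ∧ x = formClass p a b} := by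
  rw [integralSymbols, AddMonoidHom.map_closure]
  congr 1
  ext x
  constructor
  · rintro ⟨_, ⟨a, b, ha, hb, rfl⟩, rfl⟩
    exact ⟨a, b, ha, hb, he a b⟩
  · rintro ⟨a, b, ha, hb, rfl⟩
    exact ⟨_, ⟨a, b, ha, hb, rfl⟩, he a b⟩

/-- Membership form of `purityTransport_map_integralSymbols`: `α` is a `T`-integral symbolic class iff
`e α` lies in the subgroup generated by the `T`-integral form classes. [folklore] -/
theorem purityTransport_mem_integralSymbols_iff {p : ℕ} {K : Type u} [CommRing K] {n : ℕ}
    (e : KatoCohomologySymbolic p K n ≃+ KatoCohomologyDeRham p K n)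
    (he : ∀ (a : K) (b : Fin n → Kˣ), e (KatoCohomologySymbolic.symbol p a b) = formClass p a b)
    (T : Set K) (α : KatoCohomologySymbolic p K n) :
    α ∈ integralSymbols p n T ↔
      e α ∈ AddSubgroup.closure {x : KatoCohomologyDeRham p K n | ∃ (a : K) (b : Fin n → Kˣ),
        a ∈ T ∧ (∀ i, (b i : K) ∈ T ∧ (((b i)⁻¹ : Kˣ) : K) ∈ T) ∧ x = formClass p a b} := by
  rw [← purityTransport_map_integralSymbols e he T, AddSubgroup.mem_map_equiv,
    AddEquiv.symm_apply_apply]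

/-- **STUB `stub_purityTransport` (crux `PurityTransfer`, line `birth`)** — transport of purity along
the Bloch–Kato isomorphism: if `e : KatoCohomologySymbolic p K n ≃+ KatoCohomologyDeRham p K n` maps
`[a, b}` to `formClass p a b` (hypothesis `hBK`, the named fact `BlochKato1986_symbolicPresentation`),
then `e` maps `integralSymbols p n T` onto the subgroup generated by the `T`-integral form classes
(`AddMonoidHom.map_closure`), for every `T ⊆ K`; so de Rham-side Gersten purity at `B_𝔮` (hypothesis
`hdR`) gives the symbolic fact `GrosSuwa1988_purity` (`mem_heightOneIntegralSymbols_iff`,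
`AddSubgroup.mem_map_equiv`). [cite: GrosSuwa1988, Thm. 1.4; BlochKato1986, Lemma (4.2)] -/
theorem stub_purityTransport (hBK : BlochKato1986_symbolicPresentation.{u})
    (hdR : ∀ (p : ℕ), p.Prime → ∀ (k K : Type u) [Field k] [CharP k p] [PerfectField k] [Field K]
      [Algebra k K] (B : Subalgebra k K) [IsFractionRing B K], B.FG → ∀ (𝔮 : Ideal B) [𝔮.IsPrime],
      IsRegularLocalRing (Localization.AtPrime 𝔮) → ∀ (n : ℕ) (α : KatoCohomologyDeRham p K n),
        (∀ (P : Ideal (localizationIn K 𝔮)) [P.IsPrime], P.height = 1 →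
          α ∈ AddSubgroup.closure {x : KatoCohomologyDeRham p K n | ∃ (a : K) (b : Fin n → Kˣ),
            a ∈ (localizationIn K P : Set K) ∧
            (∀ i, (b i : K) ∈ (localizationIn K P : Set K) ∧
              (((b i)⁻¹ : Kˣ) : K) ∈ (localizationIn K P : Set K)) ∧
            x = formClass p a b}) →
        α ∈ AddSubgroup.closure {x : KatoCohomologyDeRham p K n | ∃ (a : K) (b : Fin n → Kˣ),
            a ∈ (localizationIn K 𝔮 : Set K) ∧
            (∀ i, (b i : K) ∈ (localizationIn K 𝔮 : Set K) ∧
              (((b i)⁻¹ : Kˣ) : K) ∈ (localizationIn K 𝔮 : Set K)) ∧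
            x = formClass p a b}) :
    GrosSuwa1988_purity.{u} := by
  intro p hp k K _ _ _ _ _ B _ hB 𝔮 _ hreg n α hα
  haveI : Fact p.Prime := ⟨hp⟩
  haveI : CharP K p := charP_of_injective_algebraMap (algebraMap k K).injective p
  obtain ⟨e, he⟩ := hBK p K n
  rw [purityTransport_mem_integralSymbols_iff e he]
  exact hdR p hp k K B hB 𝔮 hreg n (e α) fun P _ hP =>
    (purityTransport_mem_integralSymbols_iff e he _ α).1
      ((mem_heightOneIntegralSymbols_iff α).1 hα P hP)

end Summit.ResolutionOfSingularities.ResolutionOfSingularities.Theorems.WildPurityPurityTransfer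

end
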